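import Summits.ResolutionOfSingularities.ResolutionOfSingularities.Theses.Valuative
import Summits.ResolutionOfSingularities.ResolutionOfSingularities.Theses.CyclicCovers
import Literature.AlgebraicGeometry.Resolution.ResolutionLU
import Literature.AlgebraicGeometry.Resolution.LocalUniformization
import Literature.AlgebraicGeometry.Resolution.ZariskiPatchingProperModels
import Literature.AlgebraicGeometry.Resolution.ProperModelsPatchingGluing
import Literature.AlgebraicGeometry.Resolution.ProperModelsPatchingOfResolution
import Literature.AlgebraicGeometry.Morphisms.OpenGluingProofs

/-!
# Item `Patching` (stmt-ResolutionOfSingularities-0561): logical position and reduction to the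
# atom of Zariski's patching programme

Route `Valuative`, support item `Patching` (stmt-0561):
`∀ p prime, LU_p → ResolutionInChar.{0} p`, where `LU_p` is ABSOLUTE (weak) Zariski local
uniformization in characteristic `p` — verbatim the Literature definition
`LocalUniformizationInChar.{0} p` (`LocalUniformization.lean`). The route superseded it by the crux
`PatchingRel` (stmt-0642, RELATIVE antecedent `LUrel_p`), and a route review (refuter rreview1,
2026-08-15) recorded the worry that the absolute form "hides weak ⇒ strong LU (Cossart–Piltant 2008
Cor. 4.6, principalisation in regular `n`-folds) in dimension `≥ 4`".

This file makes the position of the item kernel-checked: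

* `patching_iff`, `cyclicCovers_patching_iff` — the item (and its `CyclicCovers` copy, the same
  term) IS `∀ p prime, LocalUniformizationInChar p → ResolutionInChar p`
  (definitional), and `patching_iff_forall_lu_iff_resolutionInChar` — since resolution implies local
  uniformization (`ResolutionInChar.localUniformizationInChar`, valuative criterion), the item says
  exactly that absolute LU and resolution are EQUIVALENT prime by prime.
* `patching_of_resolutionOfSingularities`, `patchingRel_of_patching` — the item is sandwiched
  between the summit and the crux: `ResolutionOfSingularities → Patching → PatchingRel`; a
  refutation of the item refutes the summit, a proof of the item proves the crux.
* `resolutionOverUpToDim_of_properPatching_of_lu` (per ground field) and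
  `resolutionInChar_of_properTwoModelPatching_of_lu` — the ABSOLUTE-LU twin of the tree theorem
  `resolutionInChar_of_properTwoModelPatching_of_relLU` (`ZariskiPatchingProperModels.lean`):
  Zariski's resolving-system argument with PROPER models consumes only absolute LU (Piltant 2013,
  Axiom 5), so two-model patching of proper models + `LU_p` ⇒ `ResolutionInChar p`.
* `resolutionInChar_iff_twoModelPatching_and_lu` — `Res_p ↔ TwoModelPatching_p ∧ LU_p`;
  `patching_iff_forall_lu_imp_twoModelPatching` — hence the item is EQUIVALENT to
  "`LU_p` ⇒ two-model patching of proper models in characteristic `p`" for every prime `p`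
  (converse by `ProperModel.twoModelPatching_of_resolutionInChar`: resolve the join).
* `resolutionInChar_of_nagata_of_sandwiched_of_lu`, `patching_of_nagata_of_sandwiched` —
  composing with the landed chain of the crux's picked line
  `sandwiched-gluing` (`SandwichedGluing.extension_of_nagata`,
  `SandwichedGluing.localRegLeification_of_openGluing_of_sandwiched`, `OpenGluing_holds`,
  `ProperModel.regLeification_of_local`, `SandwichedGluing.twoModelPatching_of_regLeification`):
  `NagataCompactification.{0}` and `SAND⁺(p) = SandwichedStrongResolution.{0} p` for all primes `p`
  imply the item. So the absolute item reduces to the SAME residual atom as the relative crux —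
  NO weak ⇒ strong local uniformization is needed along Zariski's mechanism.
* `patching_iff_patchingRel_of_lurel` — under relative LU (a theorem in dimension `≤ 3`, believed
  in general) the item and the crux are the same statement; `patching_iff_patchingRel_and_weakToStrong`
  — exactly, `Patching ↔ PatchingRel ∧ (∀ p prime, LU_p → LUrel_p)` (the extra conjunct, weak ⇒
  strong LU, is itself implied by the item).

## References

* O. Zariski, Ann. of Math. 45 (1944) 472–542, Fundamental Theorem p. 539.
* O. Piltant, *An axiomatic version of Zariski's patching theorem*, RACSAM 107 (2013) 91–121,
  p. 2, Axiom 5, Prop. 5.1, Cor. 5.7. [Piltant2013]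
* V. Cossart, O. Piltant, J. Algebra 320 (2008), Prop. 4.9 (patching from ABSOLUTE LU, trdeg 3).
  [CossartPiltant2008]
-/

noncomputable section

open CategoryTheory AlgebraicGeometry TopologicalSpace IsLocalRing
open Literature.AlgebraicGeometry Literature.AlgebraicGeometry.Resolution
open Literature.AlgebraicGeometry.Morphisms

-- `Summit.<Summit>.<Sub>.Theorems` with `Sub = Summit` (single-conjunct summit, D-0017): the
-- duplicated namespace component is the tree layout.
set_option linter.dupNamespace false

namespace Summit.ResolutionOfSingularities.ResolutionOfSingularities.Theorems

open Summit.ResolutionOfSingularities.ResolutionOfSingularities.Theses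

universe u

/-! ## The item, unfolded; its logical position -/

/-- The item `Patching` is, definitionally, "absolute local uniformization in characteristic `p`
(`LocalUniformizationInChar p`) implies resolution in characteristic `p`, for every prime `p`".
[folklore] -/
theorem patching_iff :
    Valuative.Patching ↔
      ∀ p : ℕ, p.Prime → LocalUniformizationInChar.{0} p → ResolutionInChar.{0} p :=
  Iff.rfl

/-- The `CyclicCovers` copy of the item (route `CyclicCovers`, rank 4; the item is shared) is the
same term. [folklore] -/
theorem cyclicCovers_patching_iff : CyclicCovers.Patching ↔ Valuative.Patching := Iff.rfl

/-- Since resolution implies local uniformization (valuative criterion of properness,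
`ResolutionInChar.localUniformizationInChar`), the item says exactly that ABSOLUTE local
uniformization and resolution are equivalent in every prime characteristic. [folklore] -/
theorem patching_iff_forall_lu_iff_resolutionInChar :
    Valuative.Patching ↔
      ∀ p : ℕ, p.Prime → (LocalUniformizationInChar.{0} p ↔ ResolutionInChar.{0} p) :=
  ⟨fun h p hp => ⟨h p hp, ResolutionInChar.localUniformizationInChar⟩,
    fun h p hp hLU => (h p hp).mp hLU⟩

/-- The item follows from the summit (its consequent is the summit's `p`-slice): a refutation of
`Patching` would refute `ResolutionOfSingularities`. [folklore] -/
theorem patching_of_resolutionOfSingularities (h : _root_.ResolutionOfSingularities) :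
    Valuative.Patching :=
  fun p hp _ => h p hp

/-- The item implies the crux `PatchingRel` (stmt-0642): relative local uniformization gives
absolute local uniformization (take `R = ⊥`), so the absolute item is the STRONGER implication.
[folklore] -/
theorem patchingRel_of_patching (h : Valuative.Patching) : Valuative.PatchingRel := by
  intro p hp hLU
  refine h p hp fun k K _ _ _ _ hKfg O hO => ?_
  obtain ⟨A, hA, -, hAfg, hfr, hreg⟩ := hLU k K hKfg O hO ⊥ Subalgebra.fg_bot
    (fun x hx => by
      obtain ⟨c, rfl⟩ := Algebra.mem_bot.mp hx
      exact hO c)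
  exact ⟨A, hA, hAfg, hfr, hreg⟩

/-- Under relative local uniformization in every prime characteristic (a theorem in transcendence
degree `≤ 3`, believed in general) the item and the crux `PatchingRel` are the same statement:
both then say `∀ p prime, ResolutionInChar p`. [folklore] -/
theorem patching_iff_patchingRel_of_lurel
    (hLU : ∀ p : ℕ, p.Prime → ∀ (k K : Type) [Field k] [CharP k p] [Field K] [Algebra k K],
      (⊤ : IntermediateField k K).FG → ∀ O : ValuationSubring K,
        (∀ c : k, algebraMap k K c ∈ O) → ∀ R : Subalgebra k K, R.FG →
          R.toSubring ≤ O.toSubring →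
            ∃ (A : Subalgebra k K) (h : A.toSubring ≤ O.toSubring), R ≤ A ∧ A.FG ∧
              IsFractionRing A K ∧ IsRegularLocalRing (Localization.AtPrime
                (Ideal.comap (Subring.inclusion h) (IsLocalRing.maximalIdeal O)))) :
    Valuative.Patching ↔ Valuative.PatchingRel :=
  ⟨patchingRel_of_patching, fun h p hp _ => h p hp (hLU p hp)⟩

/-- **What the absolute item adds over the relative crux, exactly**: `Patching` is equivalent to
`PatchingRel` together with "weak ⇒ strong" local uniformization in every prime characteristic
(`LU_p → LUrel_p`; Cossart–Piltant 2008, Cor. 4.6 in transcendence degree `3`). The extra conjunct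
is itself a consequence of the item (`LU_p → Res_p → LUrel_p`, `lurel_of_resolutionInChar`), which
is why it costs nothing along Zariski's mechanism (`patching_of_nagata_of_sandwiched` below).
[cite: CossartPiltant2008, Cor. 4.6] -/
theorem patching_iff_patchingRel_and_weakToStrong :
    Valuative.Patching ↔ Valuative.PatchingRel ∧
      ∀ p : ℕ, p.Prime → LocalUniformizationInChar.{0} p →
        ∀ (k K : Type) [Field k] [CharP k p] [Field K] [Algebra k K],
          (⊤ : IntermediateField k K).FG → ∀ O : ValuationSubring K,
            (∀ c : k, algebraMap k K c ∈ O) → ∀ R : Subalgebra k K, R.FG →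
              R.toSubring ≤ O.toSubring →
                ∃ (A : Subalgebra k K) (h : A.toSubring ≤ O.toSubring), R ≤ A ∧ A.FG ∧
                  IsFractionRing A K ∧ IsRegularLocalRing (Localization.AtPrime
                    (Ideal.comap (Subring.inclusion h) (IsLocalRing.maximalIdeal O))) :=
  ⟨fun h => ⟨patchingRel_of_patching h,
      fun p hp hLU => lurel_of_resolutionInChar p hp (h p hp hLU)⟩,
    fun h p hp hLU => h.1 p hp (h.2 p hp hLU)⟩

/-! ## Zariski's resolving-system argument with proper models consumes only ABSOLUTE LU -/

/-- **Resolution of an integral projective variety of ANY dimension from two-model patching of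
PROPER models and ANY supply of uniformizing affine models** (Zariski 1944; Piltant 2013, Prop.
5.1 and Cor. 5.7, with Axiom 5 = absolute local uniformization): the common generalisation of
the tree theorems `hasResolution_of_properPatching_of_relLU` (proper models, relative LU) and
`hasResolution_of_twoModelPatching_of_uniformizable` (projective models, any uniformizing
supply); proof verbatim that of the former with the resolving system taken from `hunif`.
[cite: Piltant2013, Prop. 5.1 and Cor. 5.7] -/
theorem hasResolution_of_properPatching_of_uniformizable {k : Type u} [Field k]
    (hZ : ∀ (K : Type u) [Field K] [Algebra k K] [Algebra.EssFiniteType k K],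
      ∀ M₁ M₂ : ProperModel k K,
        ∃ (N : ProperModel k K) (φ₁ : N.Hom M₁) (φ₂ : N.Hom M₂), φ₁.RegLe ∧ φ₂.RegLe)
    (hunif : ∀ (K : Type u) [Field K] [Algebra k K] (A₀ : Subalgebra k K), A₀.FG →
      IsFractionRing A₀ K → ∀ v : ZariskiRiemannSpace k K, ∃ T : Subalgebra k K,
        (T.FG ∧ IsFractionRing T K) ∧ ZariskiRiemannSpace.HasRegularCentre T v)
    {n : ℕ} (X : Scheme.{u}) [IsIntegral X]
    (ι : X ⟶ (Motives.projectiveSpace n k).left) [IsClosedImmersion ι] :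
    Scheme.HasResolution X := by
  classical
  haveI : IsProper (Motives.projectiveSpace n k).hom := Motives.isProper_projectiveSpace n k
  let πX : X ⟶ Spec (.of k) := ι ≫ (Motives.projectiveSpace n k).hom
  have hproj : Motives.IsProjectiveOver (Over.mk πX) := ⟨n, Over.homMk ι rfl, ‹_›⟩
  haveI : LocallyOfFiniteType πX := inferInstance
  -- an affine chart `U = Spec A` of `X`
  obtain ⟨_, ⟨U', hU', rfl⟩, hηU, -⟩ := X.isBasis_affineOpens.exists_subset_of_mem_open
    (Set.mem_univ (genericPoint X)) isOpen_univ
  let U : X.Opens := U'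
  have hU : IsAffineOpen U := hU'
  haveI : IsAffine U := hU
  haveI : Nonempty U := ⟨⟨_, hηU⟩⟩
  let A : Type u := Γ(U, ⊤)
  -- `A` is a finitely generated `k`-algebra
  let g : (U : Scheme.{u}) ⟶ Spec (.of k) := U.ι ≫ πX
  let ψ : k →+* A := g.appTop.hom.comp (Scheme.ΓSpecIso (.of k)).inv.hom
  have hψ : ψ.FiniteType := by
    have h1 : g.appTop.hom.FiniteType :=
      (HasRingHomProperty.iff_of_isAffine (P := @LocallyOfFiniteType)).mp inferInstance
    exact h1.comp (RingHom.FiniteType.of_surjective _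
      (Scheme.ΓSpecIso (.of k)).symm.commRingCatIsoToRingEquiv.surjective)
  letI : Algebra k A := ψ.toAlgebra
  haveI hft : Algebra.FiniteType k A := hψ
  -- its fraction field `K`, and `X` as a projective model of `K/k`
  let K : Type u := FractionRing A
  let j : Spec (.of A) ⟶ X := U.toScheme.isoSpec.inv ≫ U.ι
  have hj : j ≫ πX = Spec.map (CommRingCat.ofHom (algebraMap k A)) := by
    change (U.toScheme.isoSpec.inv ≫ U.ι) ≫ πX = Spec.map (CommRingCat.ofHom ψ)
    rw [Category.assoc, isoSpec_inv_comp]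
    rfl
  let M₀ : ProjModel k K := ProjModel.ofChart (K := K) X πX hproj A j hj
  -- `A` as a subalgebra `A₀ ⊆ K`, finitely generated with `Frac A₀ = K`
  let toK : A →ₐ[k] K := IsScalarTower.toAlgHom k A K
  let A₀ : Subalgebra k K := toK.range
  have hA₀fg : A₀.FG := by
    rw [show A₀ = Subalgebra.map toK ⊤ from (Algebra.map_top toK).symm]
    exact Subalgebra.FG.map toK hft.out
  haveI hA₀fr : IsFractionRing A₀ K := by
    refine IsFractionRing.of_field A₀ K fun z => ?_
    obtain ⟨a, b, -, rfl⟩ := IsFractionRing.div_surjective (A := A) z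
    exact ⟨⟨algebraMap A K a, a, rfl⟩, ⟨algebraMap A K b, b, rfl⟩, rfl⟩
  -- a finite resolving system of affine models, from the uniformizability hypothesis
  have hcov : ∀ v : ZariskiRiemannSpace k K, ∃ T : Subalgebra k K,
      (T.FG ∧ IsFractionRing T K) ∧ ZariskiRiemannSpace.HasRegularCentre T v :=
    hunif K A₀ hA₀fg hA₀fr
  obtain ⟨𝒯, h𝒯, h𝒯cov⟩ := exists_finite_resolvingSystem' (P := fun T => IsFractionRing T K)
    (fun T hT => (isJ2Ring_of_field k).2 T ((Subalgebra.fg_iff_finiteType T).mp hT)) hcov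
  -- their projective closures, as PROPER models: a finite resolving system of proper models
  have hM : ∀ T : ↥𝒯, ∃ M : ProperModel k K, ∀ w : ZariskiRiemannSpace k K,
      ZariskiRiemannSpace.HasRegularCentre T.1 w → M.RegCentre w := fun T => by
    haveI := (h𝒯 T.1 T.2).2
    obtain ⟨M, hM⟩ := ProjModel.exists_regCentre_of_hasRegularCentre T.1 (h𝒯 T.1 T.2).1
    exact ⟨M.toProperModel, fun w hw => (M.toProperModel_regCentre_iff w).mpr (hM w hw)⟩
  choose M hM using hM
  let l : List (ProperModel k K) := 𝒯.attach.toList.map M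
  have hlcov : ∀ v : ZariskiRiemannSpace k K, ∃ N ∈ l, N.RegCentre v := by
    intro v
    obtain ⟨T, hT, hTv⟩ := h𝒯cov v
    refine ⟨M ⟨T, hT⟩, ?_, hM ⟨T, hT⟩ v hTv⟩
    exact List.mem_map.mpr ⟨⟨T, hT⟩, Finset.mem_toList.mpr (Finset.mem_attach _ _), rfl⟩
  -- patch
  haveI : Algebra.EssFiniteType k K := inferInstance
  exact ProperModel.hasResolution_of_resolvingSystem_of_regLe (hZ K) M₀.toProperModel l hlcov

/-- **Weak resolution in every dimension over a FIXED ground field `k` from absolute local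
uniformization of the function fields over `k` and two-model patching of proper models over `k`**
(per-field form; reduction to the integral projective case by `ResolutionOverUpToDim.of_projective`:
components, Chow's lemma, projective closure). The uniformizing supply is read off absolute LU
(`exists_hasRegularCentre_of_lu`) after deriving finite generation of `K/k` from a finitely
generated affine model. [cite: Piltant2013, Axiom 5, Prop. 5.1 and Cor. 5.7] -/
theorem resolutionOverUpToDim_of_properPatching_of_lu {k : Type u} [Field k]
    (hZ : ∀ (K : Type u) [Field K] [Algebra k K] [Algebra.EssFiniteType k K],
      ∀ M₁ M₂ : ProperModel k K,
        ∃ (N : ProperModel k K) (φ₁ : N.Hom M₁) (φ₂ : N.Hom M₂), φ₁.RegLe ∧ φ₂.RegLe)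
    (hLU : ∀ (K : Type u) [Field K] [Algebra k K], (⊤ : IntermediateField k K).FG →
      ∀ O : ValuationSubring K, (∀ c : k, algebraMap k K c ∈ O) → IsLocallyUniformizable k K O)
    (d : ℕ) : ResolutionOverUpToDim k d := by
  have hU : ∀ (K : Type u) [Field K] [Algebra k K] (A₀ : Subalgebra k K), A₀.FG →
      IsFractionRing A₀ K → ∀ v : ZariskiRiemannSpace k K, ∃ T : Subalgebra k K,
        (T.FG ∧ IsFractionRing T K) ∧ ZariskiRiemannSpace.HasRegularCentre T v := by
    intro K _ _ A₀ hA₀fg hA₀fr v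
    haveI : Algebra.FiniteType k A₀ := A₀.fg_iff_finiteType.mp hA₀fg
    haveI : Algebra.EssFiniteType A₀ K :=
      Algebra.EssFiniteType.of_isLocalization K (nonZeroDivisors A₀)
    have hKfg : (⊤ : IntermediateField k K).FG :=
      IntermediateField.fg_top_iff.mpr (Algebra.EssFiniteType.comp k A₀ K)
    exact exists_hasRegularCentre_of_lu (fun O hO => hLU K hKfg O hO) v
  exact ResolutionOverUpToDim.of_projective fun _ X ι hι hint _ => by
    haveI := hι
    haveI := hint
    exact hasResolution_of_properPatching_of_uniformizable hZ hU X ι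

/-- **Resolution in characteristic `p` from ABSOLUTE local uniformization in characteristic `p`
and two-model patching of PROPER models** — the absolute twin of
`resolutionInChar_of_properTwoModelPatching_of_relLU`: Zariski's resolving-system step consumes
only Piltant's Axiom 5 (for every valuation ring SOME regular-at-the-centre affine model), so the
absolute antecedent `LU_p` of the item `Patching` suffices exactly as the relative one of the crux
`PatchingRel` does. [cite: Piltant2013, p. 2, Axiom 5 and Prop. 5.1] -/
theorem resolutionInChar_of_properTwoModelPatching_of_lu {p : ℕ}
    (hZ : ProperModel.TwoModelPatching.{0} p) (hLU : LocalUniformizationInChar.{0} p) :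
    ResolutionInChar.{0} p := by
  intro k _ _ X f hs hl hq hr
  haveI : QuasiCompact f := hq
  haveI : LocallyOfFiniteType f := hl
  haveI : CompactSpace X := QuasiCompact.compactSpace_of_compactSpace f
  obtain ⟨d, hd⟩ := exists_topologicalKrullDim_le_of_locallyOfFiniteType f
  exact resolutionOverUpToDim_of_properPatching_of_lu (fun K _ _ _ M₁ M₂ => hZ k K M₁ M₂)
    (fun K _ _ hKfg O hO => hLU k K hKfg O hO) d X f hs hl hq hr hd

/-- **`Res_p ↔ TwoModelPatching_p ∧ LU_p`** — the absolute twin of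
`ProperModel.resolutionInChar_iff_twoModelPatching_and_relLU`: the open core of Zariski's
programme and ABSOLUTE local uniformization together are exactly resolution in characteristic
`p` (`→`: resolve the join, and the valuative criterion; `←`: Zariski's resolving system).
[cite: Piltant2013, Prop. 5.1 (P = P_reg)] -/
theorem resolutionInChar_iff_twoModelPatching_and_lu (p : ℕ) :
    ResolutionInChar.{0} p ↔
      ProperModel.TwoModelPatching.{0} p ∧ LocalUniformizationInChar.{0} p :=
  ⟨fun h => ⟨ProperModel.twoModelPatching_of_resolutionInChar h,
      ResolutionInChar.localUniformizationInChar h⟩,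
    fun h => resolutionInChar_of_properTwoModelPatching_of_lu h.1 h.2⟩

/-- **Resolution in characteristic `p` from Nagata compactification, strong resolution of
sandwiched schemes and ABSOLUTE local uniformization** — the absolute twin of
`SandwichedGluing.resolutionInChar_of_nagata_openGluing_sand` (there with relative LU), with the
two-piece gluing discharged by `OpenGluing_holds`. [cite: Piltant2013, Prop. 5.1 and Cor. 5.7] -/
theorem resolutionInChar_of_nagata_of_sandwiched_of_lu (p : ℕ) (hN : NagataCompactification.{0})
    (hS : SandwichedStrongResolution.{0} p) (hLU : LocalUniformizationInChar.{0} p) :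
    ResolutionInChar.{0} p :=
  resolutionInChar_of_properTwoModelPatching_of_lu
    (SandwichedGluing.twoModelPatching_of_regLeification p
      (ProperModel.regLeification_of_local p (SandwichedGluing.extension_of_nagata hN)
        (SandwichedGluing.localRegLeification_of_openGluing_of_sandwiched p OpenGluing_holds hS)))
    hLU

/-! ## The item reduced to the atom of the crux's line -/

/-- **The item is equivalent to "absolute LU ⇒ two-model patching of proper models", prime by
prime**: `⇐` is Zariski's programme (`resolutionInChar_of_properTwoModelPatching_of_lu`), `⇒`
resolves the join of the two models (`ProperModel.twoModelPatching_of_resolutionInChar`).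
[cite: Piltant2013, Prop. 5.1 (P = P_reg)] -/
theorem patching_iff_forall_lu_imp_twoModelPatching :
    Valuative.Patching ↔
      ∀ p : ℕ, p.Prime → LocalUniformizationInChar.{0} p → ProperModel.TwoModelPatching.{0} p :=
  ⟨fun h p hp hLU => ProperModel.twoModelPatching_of_resolutionInChar (h p hp hLU),
    fun h p hp hLU => resolutionInChar_of_properTwoModelPatching_of_lu (h p hp hLU) hLU⟩

/-- Two-model patching of proper models in every prime characteristic implies the item.
[cite: Piltant2013, Prop. 5.1 (P = P_reg)] -/
theorem patching_of_properTwoModelPatching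
    (hZ : ∀ p : ℕ, p.Prime → ProperModel.TwoModelPatching.{0} p) : Valuative.Patching :=
  fun p hp hLU => resolutionInChar_of_properTwoModelPatching_of_lu (hZ p hp) hLU

/-- RegLe-ification of one morphism of proper models in every prime characteristic implies the
item (RegLe-ify twice on the join, `SandwichedGluing.twoModelPatching_of_regLeification`).
[cite: Piltant2013, Prop. 5.1 (proof, Step 2)] -/
theorem patching_of_regLeification
    (h : ∀ p : ℕ, p.Prime → ProperModel.RegLeification.{0} p) : Valuative.Patching :=
  patching_of_properTwoModelPatching fun p hp =>
    SandwichedGluing.twoModelPatching_of_regLeification p (h p hp)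

/-- **The item reduced to the atom of the crux's picked line `sandwiched-gluing`**: Nagata
compactification (named fact `NagataCompactification`, Conrad 2007 Thm. 4.1) and strong
resolution of sandwiched schemes `SAND⁺(p)` (`SandwichedStrongResolution p`, Cossart–Piltant
2019 Thm. 1.1 (i)–(ii) in dimension `≤ 3`, OPEN beyond) in every prime characteristic imply
`Patching`: resolve `φ⁻¹(Reg Y) → Reg Y` strongly and glue along the regular locus
(`OpenGluing_holds`, Stacks 01LH) to a local RegLe-ification, compactify it (Nagata) to a
RegLe-ification, RegLe-ify twice on the join to patch two proper models, and run Zariski's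
resolving-system argument on ABSOLUTE local uniformization. The absolute item therefore carries
no input beyond the relative crux `PatchingRel` along Zariski's mechanism (no weak ⇒ strong local
uniformization is used). [cite: Piltant2013, Prop. 5.1 (proof, Steps 2-5) and Cor. 5.7] -/
theorem patching_of_nagata_of_sandwiched (hN : NagataCompactification.{0})
    (hS : ∀ p : ℕ, p.Prime → SandwichedStrongResolution.{0} p) : Valuative.Patching :=
  fun p hp hLU => resolutionInChar_of_nagata_of_sandwiched_of_lu p hN (hS p hp) hLU

/-- The same reduction for the `CyclicCovers` copy of the item, which is the same term.
[folklore] -/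
theorem cyclicCovers_patching_of_nagata_of_sandwiched (hN : NagataCompactification.{0})
    (hS : ∀ p : ℕ, p.Prime → SandwichedStrongResolution.{0} p) : CyclicCovers.Patching :=
  patching_of_nagata_of_sandwiched hN hS

end Summit.ResolutionOfSingularities.ResolutionOfSingularities.Theorems

end
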